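import Literature.MathematicalPhysics.QuantumLattice.PairWordLinkedCluster
import Literature.MathematicalPhysics.QuantumLattice.VacuumConnectedCoeffBound
import HarnessLib

/-!
# The single-scale bound on the weighted connected coefficients of the word expansion

Topic `MathematicalPhysics/QuantumLattice`; the generic companion of `VacuumConnectedCoeffBound.lean`
(there: on-site quartic vertices). For the connected coefficients
`c_j = ∫_{Δ_j} (-β)^j Σ_{g : [j] → T × Λ} (∏_i v_{g i}) 𝓔ᵀ_j(g, -βu) du` of the word expansion
(`PairWordLinkedCluster.word_linkedCluster_recursion`; letters `(t, x)` = a vertex TYPE `t ∈ T` at a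
SITE `x ∈ Λ`, each a monomial of `p` pairs, weights `|v (t, x)| ≤ w t`), the `β`-uniform, `n!`-free bound
on positional sums of truncated chronological expectations
(`FermionicTree.sum_norm_ursellOf_moment_le_of_detBound`, determinant bound `2` of
`propMatrix_weightedMinor_detBound`, `p` pairs per vertex) applied to every TYPE PATTERN, the weights
summed over the types (`(Σ_t w_t)^j`) and the ordered time integral bounded by the simplex volume
(`norm_orderedIntegral_le_of_monotone`) give, for `j ≥ 1`,

`‖c_j‖ ≤ |Λ'| · (β^j / j!) · (Σ_t w_t)^j · j^{j-2} · 2^{jp} · (2p² Σ_z γ z)^{j-1}`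

(`norm_wordConnectedCoeff_le`), under an even translation-invariant line bound `γ` on the entries of
the word propagator matrices at simplex times. Hence `Σ_j g^j c_j / |Λ'|` converges for
`|g| (Σ_t w_t) ≲ (β Σ_z γ z)⁻¹` uniformly in the volume: the single-scale estimate of
Benfatto–Giuliani–Mastropietro 2006 (2.77) for mixed words.

* `word_times_antitone_window`, `wordPropMatrix_eq_propMatrix_real` — the chronological structure;
* `sum_prod_weights_eq_pow` — `Σ_{t⃗} ∏_i w(t_i) = (Σ_t w_t)^j`;
* `sum_norm_wordUrsell_le` — the positional sum at a fixed type pattern;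
* `sum_norm_weighted_wordUrsell_le` — the weighted sum over all letters;
* **`norm_wordConnectedCoeffOn_le`**, **`norm_wordConnectedCoeff_le`** — the bound on `c_j` (and on every
  restriction of its word sum).

Everything is PROVED; no definition and no named fact.

## References
* G. Benfatto, A. Giuliani, V. Mastropietro, Ann. Henri Poincaré 7 (2006) 809–898, (2.77).
  [cite: BenfattoGiulianiMastropietro2006, (2.77)]
* W. de Siqueira Pedra, M. Salmhofer, Comm. Math. Phys. 282 (2008) 797–818, Thm 2.4. [cite: PedraSalmhofer2008, Thm 2.4]
* D. Brydges, in *Critical Phenomena, Random Systems, Gauge Theories* (Les Houches 1984), §2. [cite: Brydges1986, §2]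
-/

noncomputable section

open scoped Matrix.Norms.L2Operator ComplexOrder
open Finset MeasureTheory Filter Topology NormedSpace Set
open Literature.Probability.LatticeModels
open Literature.Probability.LatticeModels.BattleFederbush

namespace Literature.MathematicalPhysics.QuantumLattice

/-! ### The chronological structure of the word propagator matrix at simplex times -/

section Chronological

variable {κ : Type*} [LinearOrder κ] [Fintype κ] (β : ℝ) (h : Matrix κ κ ℂ)
variable {R : Type*} {p : ℕ} (op om : R → Fin p → κ)

/-- **The word propagator matrix at simplex times is a chronological `propMatrix` with real pair times**
`-β u_{⌊a/p⌋}`. [folklore] -/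
theorem wordPropMatrix_eq_propMatrix_real {j : ℕ} (g : Fin j → R) (u : Fin j → ℝ) :
    wordPropMatrix β h op om g (fun i => ((u i : ℝ) : ℂ) * -(β : ℂ)) =
      propMatrix β h (fun a : Fin (j * p) => op (g (finProdFinEquiv.symm a).1) (finProdFinEquiv.symm a).2)
        (fun a : Fin (j * p) => om (g (finProdFinEquiv.symm a).1) (finProdFinEquiv.symm a).2)
        (fun a : Fin (j * p) => (((u (finProdFinEquiv.symm a).1 * -β : ℝ)) : ℂ)) := by
  unfold wordPropMatrix
  congr 1
  funext a
  push_cast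
  ring

/-- The pair times `-β u_{⌊a/p⌋}` of a monotone `u` with values in `[0, 1]` are antitone in the pair index
and lie in `[-β, 0]` (for `0 ≤ β`). [folklore] -/
theorem word_times_antitone_window {j : ℕ} {β : ℝ} (hβ : 0 ≤ β) {u : Fin j → ℝ} (hu : Monotone u)
    (hu01 : ∀ i, u i ∈ Icc (0 : ℝ) 1) :
    Antitone (fun a : Fin (j * p) => u (finProdFinEquiv.symm a).1 * -β) ∧
      ∀ a : Fin (j * p), -β ≤ u (finProdFinEquiv.symm a).1 * -β ∧
        u (finProdFinEquiv.symm a).1 * -β ≤ -β + β := by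
  constructor
  · intro a b hab
    have hdiv : (finProdFinEquiv.symm a).1 ≤ (finProdFinEquiv.symm b).1 := by
      rw [Fin.le_def]
      have h1 : ((finProdFinEquiv.symm a).1 : ℕ) = (a : ℕ) / p := by simp [finProdFinEquiv, Fin.coe_divNat]
      have h2 : ((finProdFinEquiv.symm b).1 : ℕ) = (b : ℕ) / p := by simp [finProdFinEquiv, Fin.coe_divNat]
      rw [h1, h2]
      exact Nat.div_le_div_right hab
    have := hu hdiv
    show u (finProdFinEquiv.symm b).1 * -β ≤ u (finProdFinEquiv.symm a).1 * -β
    nlinarith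
  · intro a
    have h0 := (hu01 (finProdFinEquiv.symm a).1).1
    have h1 := (hu01 (finProdFinEquiv.symm a).1).2
    constructor <;> nlinarith

end Chronological

/-! ### Summing the weights over the type patterns -/

section Weights

/-- **`Σ_{t⃗ : [j] → T} ∏_i w(t_i) = (Σ_t w_t)^j`.** [folklore] -/
theorem sum_prod_weights_eq_pow {T : Type*} [Fintype T] [DecidableEq T] (w : T → ℝ) (j : ℕ) :
    ∑ t : Fin j → T, ∏ i, w (t i) = (∑ s, w s) ^ j := by
  rw [Finset.sum_pow', Fintype.piFinset_univ]

end Weights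

/-! ### The positional sum at a fixed type pattern -/

section Positional

variable {κ : Type*} [LinearOrder κ] [Fintype κ] (β : ℝ) (h : Matrix κ κ ℂ)
variable {T : Type*} [Fintype T] {Λ : Type*} [Fintype Λ] {p : ℕ} (op om : T × Λ → Fin p → κ)
variable {Λ' : Type*} [AddCommGroup Λ'] [Fintype Λ'] [DecidableEq Λ']

omit [Fintype T] [Fintype Λ] in
/-- **The positional sum of the truncated expectations of a word at a fixed type pattern, uniformly in
`β` and in the volume**: for Hermitian `h`, `0 ≤ β`, monotone simplex times `u ∈ [0,1]^j`, sites
identified with a finite abelian group `Λ'` by `pos`, an even translation-invariant line bound `γ` on the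
entries of the word propagator matrices, a type pattern `t⃗`, a vertex `v₀` and `a ∈ Λ'`:
`Σ_{x⃗ : pos x_{v₀} = a} |𝓔ᵀ_j((t⃗, x⃗), -βu)| ≤ j^{j-2} · 2^{jp} · (2p² Σ_z γ z)^{j-1}`
(determinant bound `2`, `p` pairs per vertex, tree decay). [cite: BenfattoGiulianiMastropietro2006, (2.77)] -/
theorem sum_norm_wordUrsell_le (hh : h.IsHermitian) (hβ : 0 ≤ β) (pos : Λ ≃ Λ')
    (γ : Λ' → ℝ) (hγ0 : ∀ z, 0 ≤ γ z) (hγ : ∀ z, γ (-z) = γ z)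
    {j : ℕ} (u : Fin j → ℝ) (hum : Monotone u) (hu01 : ∀ i, u i ∈ Icc (0 : ℝ) 1)
    (t : Fin j → T)
    (hG : ∀ (g : Fin j → Λ) (a b : Fin (j * p)),
      ‖wordPropMatrix β h op om (fun i => (t i, g i)) (fun i => ((u i : ℝ) : ℂ) * -(β : ℂ)) a b‖ ≤
        γ (pos (g (wordCluster p j a)) - pos (g (wordCluster p j b))))
    (v₀ : Fin j) (a : Λ') :
    ∑ x ∈ univ.filter (fun x : Fin j → Λ' => x v₀ = a),
        ‖ursellOf (FermionicTree.moment (wordCluster p j)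
          (wordPropMatrix β h op om (fun i => (t i, pos.symm (x i)))
            (fun i => ((u i : ℝ) : ℂ) * -(β : ℂ)))) univ‖ ≤
      (j : ℝ) ^ (j - 2) * ((2 : ℝ) ^ (j * p) * (2 * (p : ℝ) ^ 2 * ∑ z, γ z) ^ (j - 1)) := by
  have key := FermionicTree.sum_norm_ursellOf_moment_le_of_detBound (𝕜 := ℂ) (wordCluster p j)
    (fun x : Fin j → Λ' => wordPropMatrix β h op om (fun i => (t i, pos.symm (x i)))
      (fun i => ((u i : ℝ) : ℂ) * -(β : ℂ)))
    (δ := 2) (by norm_num) (fun x => ?_) γ hγ0 hγ (fun x f f' => ?_) p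
    (fun y => (card_fieldsOf_wordCluster_singleton p j y).le) a (v := v₀)
  · refine key.trans (le_of_eq ?_)
    rw [Fintype.card_fin, Fintype.card_fin]
  · -- the determinant bound `2`, from the chronological structure
    obtain ⟨hanti, hwin⟩ := word_times_antitone_window (p := p) (j := j) hβ hum hu01
    rw [wordPropMatrix_eq_propMatrix_real]
    exact propMatrix_weightedMinor_detBound hh β (-β) _ _ _ hanti hwin
  · -- the line bound
    have := hG (fun i => pos.symm (x i)) f f'
    simpa using this

/-! ### The weighted sum over all letters -/

/-- **The weighted sum of the truncated expectations over all words of length `j`**: with weights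
`|v (t, x)| ≤ w t` and the line bound `hG` for every type pattern,
`Σ_{g : [j] → T × Λ} |∏_i v_{g i}| · |𝓔ᵀ_j(g, -βu)| ≤ (Σ_t w_t)^j · |Λ'| · j^{j-2} · 2^{jp} · (2p² Σ_z γ z)^{j-1}`
(`j ≥ 1`, `w ≥ 0`). [cite: BenfattoGiulianiMastropietro2006, (2.77)] -/
theorem sum_norm_weighted_wordUrsell_le [DecidableEq T] (hh : h.IsHermitian) (hβ : 0 ≤ β) (pos : Λ ≃ Λ')
    (γ : Λ' → ℝ) (hγ0 : ∀ z, 0 ≤ γ z) (hγ : ∀ z, γ (-z) = γ z)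
    (v : T × Λ → ℂ) (w : T → ℝ) (hw0 : ∀ s, 0 ≤ w s) (hw : ∀ s x, ‖v (s, x)‖ ≤ w s)
    {j : ℕ} (hj : 1 ≤ j) (u : Fin j → ℝ) (hum : Monotone u) (hu01 : ∀ i, u i ∈ Icc (0 : ℝ) 1)
    (hG : ∀ (t : Fin j → T) (g : Fin j → Λ) (a b : Fin (j * p)),
      ‖wordPropMatrix β h op om (fun i => (t i, g i)) (fun i => ((u i : ℝ) : ℂ) * -(β : ℂ)) a b‖ ≤
        γ (pos (g (wordCluster p j a)) - pos (g (wordCluster p j b)))) :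
    ∑ g : Fin j → T × Λ, ‖(∏ i, v (g i)) *
        ursellOf (FermionicTree.moment (wordCluster p j)
          (wordPropMatrix β h op om g (fun i => ((u i : ℝ) : ℂ) * -(β : ℂ)))) univ‖ ≤
      (∑ s, w s) ^ j * ((Fintype.card Λ' : ℝ) *
        ((j : ℝ) ^ (j - 2) * ((2 : ℝ) ^ (j * p) * (2 * (p : ℝ) ^ 2 * ∑ z, γ z) ^ (j - 1)))) := by
  classical
  set K : ℝ := (j : ℝ) ^ (j - 2) * ((2 : ℝ) ^ (j * p) * (2 * (p : ℝ) ^ 2 * ∑ z, γ z) ^ (j - 1)) with hK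
  have hγ1 : 0 ≤ ∑ z, γ z := sum_nonneg fun z _ => hγ0 z
  have hK0 : 0 ≤ K := by positivity
  set v₀ : Fin j := ⟨0, hj⟩ with hv₀
  -- split the letters into type pattern and positions
  set N : (Fin j → T × Λ) → ℝ := fun g => ‖(∏ i, v (g i)) *
        ursellOf (FermionicTree.moment (wordCluster p j)
          (wordPropMatrix β h op om g (fun i => ((u i : ℝ) : ℂ) * -(β : ℂ)))) univ‖ with hN
  let e : (Fin j → T × Λ) ≃ (Fin j → T) × (Fin j → Λ') :=
    ((Equiv.refl (Fin j)).arrowCongr ((Equiv.refl T).prodCongr pos)).trans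
      (Equiv.arrowProdEquivProdArrow (Fin j) (fun _ => T) (fun _ => Λ'))
  have hsplit : ∑ g : Fin j → T × Λ, N g =
      ∑ t : Fin j → T, ∑ x : Fin j → Λ', N (fun i => (t i, pos.symm (x i))) := by
    rw [← Fintype.sum_prod_type']
    refine Fintype.sum_equiv e _ _ fun g => ?_
    congr 1
    funext i
    simp [e, Equiv.arrowCongr, Equiv.prodCongr]
  change ∑ g : Fin j → T × Λ, N g ≤ _
  rw [hsplit]
  simp only [hN]
  -- bound each type pattern
  have hpat : ∀ t : Fin j → T, ∑ x : Fin j → Λ', ‖(∏ i, v (t i, pos.symm (x i))) *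
        ursellOf (FermionicTree.moment (wordCluster p j)
          (wordPropMatrix β h op om (fun i => (t i, pos.symm (x i)))
            (fun i => ((u i : ℝ) : ℂ) * -(β : ℂ)))) univ‖ ≤
      (∏ i, w (t i)) * ((Fintype.card Λ' : ℝ) * K) := by
    intro t
    have hprod : ∀ x : Fin j → Λ', ‖∏ i, v (t i, pos.symm (x i))‖ ≤ ∏ i, w (t i) := fun x => by
      rw [norm_prod]
      exact Finset.prod_le_prod (fun i _ => norm_nonneg _) fun i _ => hw _ _
    calc ∑ x : Fin j → Λ', ‖(∏ i, v (t i, pos.symm (x i))) *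
          ursellOf (FermionicTree.moment (wordCluster p j)
            (wordPropMatrix β h op om (fun i => (t i, pos.symm (x i)))
              (fun i => ((u i : ℝ) : ℂ) * -(β : ℂ)))) univ‖
        ≤ ∑ x : Fin j → Λ', (∏ i, w (t i)) * ‖ursellOf (FermionicTree.moment (wordCluster p j)
            (wordPropMatrix β h op om (fun i => (t i, pos.symm (x i)))
              (fun i => ((u i : ℝ) : ℂ) * -(β : ℂ)))) univ‖ := by
          refine sum_le_sum fun x _ => ?_
          rw [norm_mul]
          exact mul_le_mul_of_nonneg_right (hprod x) (norm_nonneg _)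
      _ = (∏ i, w (t i)) * ∑ x : Fin j → Λ', ‖ursellOf (FermionicTree.moment (wordCluster p j)
            (wordPropMatrix β h op om (fun i => (t i, pos.symm (x i)))
              (fun i => ((u i : ℝ) : ℂ) * -(β : ℂ)))) univ‖ := by rw [Finset.mul_sum]
      _ ≤ (∏ i, w (t i)) * ((Fintype.card Λ' : ℝ) * K) := by
          refine mul_le_mul_of_nonneg_left ?_ (prod_nonneg fun i _ => hw0 _)
          rw [← Finset.sum_fiberwise_of_maps_to (g := fun x : Fin j → Λ' => x v₀) (t := univ)
            (fun x _ => mem_univ _)]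
          calc ∑ a ∈ (univ : Finset Λ'), ∑ x ∈ univ.filter (fun x : Fin j → Λ' => x v₀ = a),
                ‖ursellOf (FermionicTree.moment (wordCluster p j)
                  (wordPropMatrix β h op om (fun i => (t i, pos.symm (x i)))
                    (fun i => ((u i : ℝ) : ℂ) * -(β : ℂ)))) univ‖
              ≤ ∑ _a ∈ (univ : Finset Λ'), K :=
                sum_le_sum fun a _ => sum_norm_wordUrsell_le β h op om hh hβ pos γ hγ0 hγ u hum hu01 t
                  (hG t) v₀ a
            _ = (Fintype.card Λ' : ℝ) * K := by rw [sum_const, card_univ, nsmul_eq_mul]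
  calc _ ≤ ∑ t : Fin j → T, (∏ i, w (t i)) * ((Fintype.card Λ' : ℝ) * K) := sum_le_sum fun t _ => hpat t
    _ = (∑ s, w s) ^ j * ((Fintype.card Λ' : ℝ) * K) := by
        rw [← Finset.sum_mul, sum_prod_weights_eq_pow]

/-! ### The bound on the connected coefficient -/

/-- **The single-scale bound on restricted weighted connected coefficients of the word expansion,
extensive in the volume**: under the line bound `hG` (for all monotone simplex times and all type patterns)
and the weight bound `|v (t, x)| ≤ w t`, for `j ≥ 1` and EVERY set `S` of words of length `j`,
`‖∫_{Δ_j} (-β)^j Σ_{g ∈ S} (∏ v_{g i}) 𝓔ᵀ_j(g, -βu) du‖ ≤ |Λ'| · (β^j/j!) · (Σ_t w_t)^j · j^{j-2} · 2^{jp} · (2p² Σ_z γ z)^{j-1}`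
(restricting the words — e.g. to a fixed number of letters of a given type, as in coefficient extraction —
only decreases the sum of absolute values). [cite: BenfattoGiulianiMastropietro2006, (2.77)] -/
theorem norm_wordConnectedCoeffOn_le [DecidableEq T] (hh : h.IsHermitian) (hβ : 0 ≤ β) (pos : Λ ≃ Λ')
    (γ : Λ' → ℝ) (hγ0 : ∀ z, 0 ≤ γ z) (hγ : ∀ z, γ (-z) = γ z)
    (v : T × Λ → ℂ) (w : T → ℝ) (hw0 : ∀ s, 0 ≤ w s) (hw : ∀ s x, ‖v (s, x)‖ ≤ w s)
    {j : ℕ} (hj : 1 ≤ j)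
    (hG : ∀ (u : Fin j → ℝ), Monotone u → (∀ i, u i ∈ Icc (0 : ℝ) 1) →
      ∀ (t : Fin j → T) (g : Fin j → Λ) (a b : Fin (j * p)),
        ‖wordPropMatrix β h op om (fun i => (t i, g i)) (fun i => ((u i : ℝ) : ℂ) * -(β : ℂ)) a b‖ ≤
          γ (pos (g (wordCluster p j a)) - pos (g (wordCluster p j b))))
    (S : Finset (Fin j → T × Λ)) :
    ‖orderedIntegral j (fun u : Fin j → ℝ => (-(β : ℂ)) ^ j * ∑ g ∈ S, (∏ i, v (g i)) *
        ursellOf (FermionicTree.moment (wordCluster p j)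
          (wordPropMatrix β h op om g (fun i => ((u i : ℝ) : ℂ) * -(β : ℂ)))) univ) 1‖ ≤
      (Fintype.card Λ' : ℝ) * (β ^ j / j.factorial) * ((∑ s, w s) ^ j *
        ((j : ℝ) ^ (j - 2) * ((2 : ℝ) ^ (j * p) * (2 * (p : ℝ) ^ 2 * ∑ z, γ z) ^ (j - 1)))) := by
  classical
  set K : ℝ := (j : ℝ) ^ (j - 2) * ((2 : ℝ) ^ (j * p) * (2 * (p : ℝ) ^ 2 * ∑ z, γ z) ^ (j - 1)) with hK
  have hγ1 : 0 ≤ ∑ z, γ z := sum_nonneg fun z _ => hγ0 z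
  have hK0 : 0 ≤ K := by positivity
  have hW0 : 0 ≤ (∑ s, w s) ^ j * ((Fintype.card Λ' : ℝ) * K) := by
    have := sum_norm_weighted_wordUrsell_le β h op om hh hβ pos γ hγ0 hγ v w hw0 hw hj
      (fun i : Fin j => (0 : ℝ)) monotone_const (fun i => ⟨le_rfl, zero_le_one⟩)
      (hG _ monotone_const (fun i => ⟨le_rfl, zero_le_one⟩))
    exact (sum_nonneg fun g _ => norm_nonneg _).trans this
  -- pointwise bound on the simplex
  have hpt : ∀ u : Fin j → ℝ, Monotone u → (∀ i, u i ∈ Icc (0 : ℝ) 1) →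
      ‖(-(β : ℂ)) ^ j * ∑ g ∈ S, (∏ i, v (g i)) *
        ursellOf (FermionicTree.moment (wordCluster p j)
          (wordPropMatrix β h op om g (fun i => ((u i : ℝ) : ℂ) * -(β : ℂ)))) univ‖ ≤
        β ^ j * ((∑ s, w s) ^ j * ((Fintype.card Λ' : ℝ) * K)) := by
    intro u hum hu01
    rw [norm_mul, norm_pow, norm_neg, Complex.norm_real, Real.norm_of_nonneg hβ]
    refine mul_le_mul_of_nonneg_left ?_ (pow_nonneg hβ _)
    refine (norm_sum_le _ _).trans ?_
    refine (Finset.sum_le_sum_of_subset_of_nonneg (Finset.subset_univ S) fun g _ _ => norm_nonneg _).trans ?_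
    exact sum_norm_weighted_wordUrsell_le β h op om hh hβ pos γ hγ0 hγ v w hw0 hw hj u hum hu01 (hG u hum hu01)
  calc _ ≤ β ^ j * ((∑ s, w s) ^ j * ((Fintype.card Λ' : ℝ) * K)) * 1 ^ j / j.factorial :=
        norm_orderedIntegral_le_of_monotone j _ zero_le_one (by positivity) hpt
    _ = (Fintype.card Λ' : ℝ) * (β ^ j / j.factorial) * ((∑ s, w s) ^ j * K) := by rw [one_pow]; ring

/-- **The single-scale bound on the weighted connected coefficient of the word expansion, extensive in
the volume**: under the line bound `hG` (for all monotone simplex times and all type patterns) and the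
weight bound `|v (t, x)| ≤ w t`, for `j ≥ 1`,
`‖c_j‖ ≤ |Λ'| · (β^j/j!) · (Σ_t w_t)^j · j^{j-2} · 2^{jp} · (2p² Σ_z γ z)^{j-1}`,
`c_j = ∫_{Δ_j} (-β)^j Σ_g (∏ v_{g i}) 𝓔ᵀ_j(g, -βu) du` (`wordUrsellIntegrand`). With `j^{j-2}/j! ≤ e^j`: the
series `Σ_j c_j / |Λ'|` converges absolutely once `e β (Σ_t w_t) 2^p (2p² Σ_z γ z) < 1`, uniformly in the
volume — BGM 2006 (2.77) at a single scale, mixed words. [cite: BenfattoGiulianiMastropietro2006, (2.77)] -/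
theorem norm_wordConnectedCoeff_le [DecidableEq T] (hh : h.IsHermitian) (hβ : 0 ≤ β) (pos : Λ ≃ Λ')
    (γ : Λ' → ℝ) (hγ0 : ∀ z, 0 ≤ γ z) (hγ : ∀ z, γ (-z) = γ z)
    (v : T × Λ → ℂ) (w : T → ℝ) (hw0 : ∀ s, 0 ≤ w s) (hw : ∀ s x, ‖v (s, x)‖ ≤ w s)
    {j : ℕ} (hj : 1 ≤ j)
    (hG : ∀ (u : Fin j → ℝ), Monotone u → (∀ i, u i ∈ Icc (0 : ℝ) 1) →
      ∀ (t : Fin j → T) (g : Fin j → Λ) (a b : Fin (j * p)),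
        ‖wordPropMatrix β h op om (fun i => (t i, g i)) (fun i => ((u i : ℝ) : ℂ) * -(β : ℂ)) a b‖ ≤
          γ (pos (g (wordCluster p j a)) - pos (g (wordCluster p j b)))) :
    ‖orderedIntegral j (wordUrsellIntegrand β h op om v j) 1‖ ≤
      (Fintype.card Λ' : ℝ) * (β ^ j / j.factorial) * ((∑ s, w s) ^ j *
        ((j : ℝ) ^ (j - 2) * ((2 : ℝ) ^ (j * p) * (2 * (p : ℝ) ^ 2 * ∑ z, γ z) ^ (j - 1)))) :=
  norm_wordConnectedCoeffOn_le β h op om hh hβ pos γ hγ0 hγ v w hw0 hw hj hG univ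

end Positional

end Literature.MathematicalPhysics.QuantumLattice
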